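import Mathlib
import HarnessLib.Audit
import Summits.PneNP.PneNP.Theorems.PstarChordReadPrivSwitch

/-!
# Slice genericity is the absence of PAIR-CORES: the typed form of (Ra) (ROUND-24, O1 at exact tightness; memo g21 §17)

FRONTIER range-avoidance ladder, rung F-N3, ROUND 24 (cell `pnp-ideate`, planner memo `r24/CORE-BOUND-NOTES.md` §14.29 (Ra), prover-2 memo
`g21/O1-CHORD-READ-g21.md` §17; typed target `PstarCoreBoundTargets.TerminalPeelable` (p646951); restricted-model proof complexity — nothing here
bears on `P` versus `NP`).

After `PstarChordReadTight.false_of_tight_two_generic` the ONLY non-kernel input of the O1-at-`k = 12` chain is the per-chord predicate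
`PstarChordReadLemma.SliceGeneric` (certified by kit j314774; its exact failure set at tight `k = 12` is "the chord closes an XOR 3-cycle with a
triangle non-chord and a half-chord", memo §15.2).  This file reduces it to a finite-configuration statement of the same kind as `Terminal`:

* `PairCore I y K c t R` — a non-empty `K` (⊆ `J₀ ∖ c` in the application) that is (T3)+(M0) for the reader pair (ℓ, R), where
  ℓ = `({vars c 0, vars c 1}, ∅, t)` is the BARE PAIR-READ of the chord's XOR endpoints and `R` a G-constraint; both constraints are needed
  (dropping ℓ or `R` makes `K` feasible).  Not literally a `Terminal` (no XOR-closedness: `PairCore.xor_bdry_subset` — the boundary XOR variables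
  of `K` lie in `{vars c 0, vars c 1} ∪ R.1`, nothing more).
* `phi_of_forall_ne` — the degenerate case `K = ∅`: a G-constraint missing a value on the whole hyperplane `{x_a ⊕ x_b = t}` is a function of
  `x_a ⊕ x_b` (typed: `a, b` are in no monomial).
* **`sliceGeneric_of_no_pairCore`** — if NO `K ⊆ J₀ ∖ c` is a pair-core for `c` with a reader drawn from the menu `𝒢` (disjoint from `J₀`,
  `#J₀ ≤ r`), then `SliceGeneric I y J₀ c 𝒢`.  Proof: `gSat` when the pair-read is not needed; otherwise a cardinality-minimal infeasible
  sub-family is a pair-core or empty.  (The converse direction is not needed by the chain and not proved.)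

So (Ra) for the two-chord theorem reads: pair-cores do not exist (memo §17.2: this is `GSat` for a family with ONE AND-less member — expansion
deficit `1/2`; note that the lift of `PstarChordReadsLift` covers the sub-variety `{x_q = 1}` of `Sol(J₀)`, which mixes both slices, and does NOT
give either slice `t` by itself; the census says the only obstruction at `k = 12` is `K = {t, o}` closing a 3-cycle with `c`).  No Assumption A.
-/

set_option linter.dupNamespace false -- `Summit.PneNP.PneNP.…`: summit = sub-problem name (D-0017 single-conjunct layout)

open Finset Literature.Computability.Complexity
open Summit.PneNP.PneNP.Theorems.PstarFibrePolys (bit bit_injective bit_xor bit_and)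
open Summit.PneNP.PneNP.Theorems.PstarPDT (bit_eval)
open Summit.PneNP.PneNP.Theorems.PstarTyped (Typed)
open Summit.PneNP.PneNP.Theorems.PstarSALevel (varSet bdry BoundaryExpanding SimpleOverlap)
open Summit.PneNP.PneNP.Theorems.PstarGapPeeling (eval_update_of_not_mem)
open Summit.PneNP.PneNP.Theorems.PstarCentreFree (vars_mem_varSet)
open Summit.PneNP.PneNP.Theorems.PstarGapOneAll (gval)
open Summit.PneNP.PneNP.Theorems.PstarGConstraint (gval_update_of_forall_ne)
open Summit.PneNP.PneNP.Theorems.PstarGSat (gSat)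
open Summit.PneNP.PneNP.Theorems.PstarNorCoreTools (eq_of_mem_bdry)
open Summit.PneNP.PneNP.Theorems.PstarChordReadsMirror (gval_pair)
open Summit.PneNP.PneNP.Theorems.PstarChordReadLemma (SliceGeneric)
open Summit.PneNP.PneNP.Theorems.PstarChordReadFlip
open Summit.PneNP.PneNP.Theorems.PstarChordReadOutside
open Summit.PneNP.PneNP.Theorems.PstarChordReadOutsideClean
open Summit.PneNP.PneNP.Theorems.PstarChordReadPrivSwitch

namespace Summit.PneNP.PneNP.Theorems.PstarChordReadPairCore

variable {n m : ℕ}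

/-- **PAIR-CORE** of the chord `c` at slice value `t` for the reader `R = (C, G, b)`: a non-empty family `K` such that
`K ∧ (x_{vars c 0} ⊕ x_{vars c 1} = t) ∧ (R = b)` is infeasible (T3), feasible after deleting any output of `K` (M0), and feasible after
deleting either of the two constraints. -/
def PairCore (I : LocalMap 4 n m) (y : Fin m → Bool) (K : Finset (Fin m)) (c : Fin m) (t : Bool) (R : Finset (Fin n) × Finset (Fin m) × Bool) :
    Prop :=
  K.Nonempty ∧
  (¬ ∃ x : Fin n → Bool, (∀ j ∈ K, I.eval x j = y j) ∧ xor (x (I.vars c 0)) (x (I.vars c 1)) = t ∧ gval I R.1 R.2.1 x = R.2.2) ∧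
  (∀ f ∈ K, ∃ x : Fin n → Bool, (∀ j ∈ K.erase f, I.eval x j = y j) ∧ xor (x (I.vars c 0)) (x (I.vars c 1)) = t ∧ gval I R.1 R.2.1 x = R.2.2) ∧
  (∃ x : Fin n → Bool, (∀ j ∈ K, I.eval x j = y j) ∧ gval I R.1 R.2.1 x = R.2.2) ∧
  (∃ x : Fin n → Bool, (∀ j ∈ K, I.eval x j = y j) ∧ xor (x (I.vars c 0)) (x (I.vars c 1)) = t)

section Structure

variable {I : LocalMap 4 n m} {y : Fin m → Bool} {K : Finset (Fin m)} {c : Fin m} {t : Bool} {R : Finset (Fin n) × Finset (Fin m) × Bool}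

/-- Flipping an XOR-slot variable of a pure output flips it (typed instance: the variable is not in the AND pair). -/
theorem eval_update_xor_slot (hI : I.IsPure xorAndPred) (hT : Typed I) (f : Fin m) {s : Fin 4} (hs : s.val < 2) (x : Fin n → Bool) :
    I.eval (Function.update x (I.vars f s) (!x (I.vars f s))) f = !I.eval x f := by
  apply bit_injective
  have h01 : I.vars f 0 ≠ I.vars f 1 := fun h => absurd (hI.2 f h) (by decide)
  have h2 : I.vars f 2 ≠ I.vars f s := fun h => hT f f s 2 hs (by decide) h.symm
  have h3 : I.vars f 3 ≠ I.vars f s := fun h => hT f f s 3 hs (by decide) h.symm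
  have hnot : ∀ u : Bool, bit (!u) = bit u + 1 := by decide
  rw [hnot, bit_eval hI, bit_eval hI, Function.update_of_ne h2, Function.update_of_ne h3]
  have hs01 : s = 0 ∨ s = 1 := by
    rcases Nat.lt_or_ge s.val 1 with h | h
    · exact Or.inl (Fin.ext (show s.val = 0 by omega))
    · exact Or.inr (Fin.ext (show s.val = 1 by omega))
  rcases hs01 with rfl | rfl
  · rw [Function.update_self, Function.update_of_ne h01.symm, hnot]; ring
  · rw [Function.update_self, Function.update_of_ne h01, hnot]; ring

/-- **The boundary XOR variables of a pair-core are read**: each lies in `{vars c 0, vars c 1}` or in the linear part of `R` (typed instance;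
otherwise it would repair its own output at the (M0) witness). -/
theorem PairCore.xor_bdry_subset (hI : I.IsPure xorAndPred) (hT : Typed I) (h : PairCore I y K c t R) {f : Fin m} (hf : f ∈ K) {s : Fin 4}
    (hs : s.val < 2) (hb : I.vars f s ∈ bdry I K) : I.vars f s = I.vars c 0 ∨ I.vars f s = I.vars c 1 ∨ I.vars f s ∈ R.1 := by
  classical
  by_contra hno
  push Not at hno
  obtain ⟨h0, h1, hC⟩ := hno
  obtain ⟨-, hT3, hM0, -, -⟩ := h
  obtain ⟨x, hx, hxs, hxR⟩ := hM0 f hf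
  set u := I.vars f s with hu
  -- the monomials of `R` avoid the XOR-type variable `u`
  have hG : ∀ g ∈ R.2.1, I.vars g 2 ≠ u ∧ I.vars g 3 ≠ u :=
    fun g _ => ⟨fun e => hT f g s 2 hs (by decide) (hu ▸ e.symm), fun e => hT f g s 3 hs (by decide) (hu ▸ e.symm)⟩
  by_cases hxf : I.eval x f = y f
  · exact hT3 ⟨x, fun j hj => if hjf : j = f then hjf ▸ hxf else hx j (mem_erase.2 ⟨hjf, hj⟩), hxs, hxR⟩
  · refine hT3 ⟨Function.update x u (!x u), fun j hj => ?_, ?_, ?_⟩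
    · by_cases hjf : j = f
      · subst hjf
        rw [hu, eval_update_xor_slot hI hT j hs x]
        revert hxf; cases I.eval x j <;> cases y j <;> decide
      · have hju : u ∉ varSet I j := fun huj => hjf (eq_of_mem_bdry I hj hf hb huj (hu ▸ vars_mem_varSet I f s))
        rw [eval_update_of_not_mem I j x hju]
        exact hx j (mem_erase.2 ⟨hjf, hj⟩)
    · rw [Function.update_of_ne (Ne.symm h0), Function.update_of_ne (Ne.symm h1)]; exact hxs
    · rw [gval_update_of_forall_ne I x hC hG]; exact hxR

end Structure

/-! ## The degenerate case and the reduction -/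
section Reduction

variable {I : LocalMap 4 n m} {r : ℕ} {y : Fin m → Bool} {J₀ : Finset (Fin m)} {c : Fin m} {𝒢 : Finset (Fin m)}

/-- **`K = ∅`**: a G-constraint (no monomial on the XOR-type variables `a ≠ b`) missing `b` on the whole hyperplane `{x_a ⊕ x_b = t}` is a function
of `x_a ⊕ x_b`. -/
theorem phi_of_forall_ne (hI : I.IsPure xorAndPred) (hS : SimpleOverlap I) {a b' : Fin n} (hab : a ≠ b') {C : Finset (Fin n)} {G : Finset (Fin m)}
    (hGa : ∀ g ∈ G, I.vars g 2 ≠ a ∧ I.vars g 3 ≠ a) (hGb : ∀ g ∈ G, I.vars g 2 ≠ b' ∧ I.vars g 3 ≠ b') {t b : Bool}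
    (h : ∀ x : Fin n → Bool, xor (x a) (x b') = t → gval I C G x ≠ b) :
    ∃ φ : Bool → Bool, ∀ x : Fin n → Bool, gval I C G x = φ (xor (x a) (x b')) := by
  classical
  -- the moves of `a` and `b'` are the constants `[a ∈ C]`, `[b' ∈ C]`
  have mva : ∀ x, mv I C G a x = decide (a ∈ C) := fun x => by
    by_cases ha : a ∈ C
    · rw [mv_of_lin I hI hS ha hGa, decide_eq_true ha]
    · rw [mv_eq_false_of_invisible hI hS ha hGa, decide_eq_false ha]
  have mvb : ∀ x, mv I C G b' x = decide (b' ∈ C) := fun x => by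
    by_cases hb : b' ∈ C
    · rw [mv_of_lin I hI hS hb hGb, decide_eq_true hb]
    · rw [mv_eq_false_of_invisible hI hS hb hGb, decide_eq_false hb]
  -- on the hyperplane the value is `¬b`; flipping both `a` and `b'` stays on it, so `[a ∈ C] = [b' ∈ C]`
  have hval : ∀ x : Fin n → Bool, xor (x a) (x b') = t → gval I C G x = !b := fun x hx => by
    have := h x hx; revert this; cases gval I C G x <;> cases b <;> decide
  have hCC : decide (a ∈ C) = decide (b' ∈ C) := by
    -- a point on the hyperplane
    let x₀ : Fin n → Bool := Function.update (fun _ => false) a t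
    have hx₀ : xor (x₀ a) (x₀ b') = t := by
      simp only [x₀, Function.update_self, Function.update_of_ne hab.symm]; cases t <;> rfl
    have hno : ∀ g ∈ G, ¬ ((I.vars g 2 = b' ∧ I.vars g 3 = a) ∨ (I.vars g 2 = a ∧ I.vars g 3 = b')) :=
      fun g hg H => H.elim (fun H => (hGa g hg).2 H.2) (fun H => (hGa g hg).1 H.1)
    have e := gval_flip₂ I C G hI x₀ hab hno
    rw [mva, mvb, hval x₀ hx₀, hval _ (by
      rw [Function.update_self, Function.update_of_ne hab, Function.update_self]
      revert hx₀; cases x₀ a <;> cases x₀ b' <;> cases t <;> decide)] at e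
    revert e; cases decide (a ∈ C) <;> cases decide (b' ∈ C) <;> cases b <;> decide
  refine ⟨fun u => if u = t then !b else xor (!b) (decide (a ∈ C)), fun x => ?_⟩
  dsimp only
  by_cases hx : xor (x a) (x b') = t
  · rw [if_pos hx]; exact hval x hx
  · rw [if_neg hx]
    -- flip `a` to land on the hyperplane
    have hx' : xor (Function.update x a (!x a) a) (Function.update x a (!x a) b') = t := by
      rw [Function.update_self, Function.update_of_ne hab.symm]
      revert hx; cases x a <;> cases x b' <;> cases t <;> decide
    have e := gval_flip I C G hI x a
    rw [mva, hval _ hx'] at e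
    revert e; cases gval I C G x <;> cases decide (a ∈ C) <;> cases b <;> decide

/-- **SLICE GENERICITY FROM THE ABSENCE OF PAIR-CORES.**  On a pure typed `(r,3/2)`-expanding instance with simple overlaps: `c ∈ J₀`, `#J₀ ≤ r`,
the menu `𝒢` disjoint from `J₀`; if no `K ⊆ J₀ ∖ c` is a pair-core for `c` with a reader `(C, G, b)`, `G ⊆ 𝒢`, then `c` is slice-generic for `𝒢`. -/
theorem sliceGeneric_of_no_pairCore (hI : I.IsPure xorAndPred) (hT : Typed I) (hS : SimpleOverlap I) (hB : BoundaryExpanding r I)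
    (hJr : J₀.card ≤ r) (hdisj : Disjoint J₀ 𝒢)
    (hno : ∀ K ⊆ J₀.erase c, ∀ (C : Finset (Fin n)) (G : Finset (Fin m)) (t b : Bool), G ⊆ 𝒢 → ¬ PairCore I y K c t (C, G, b)) :
    SliceGeneric I y J₀ c 𝒢 := by
  classical
  intro C G t b hp hq hG hfail
  have h01 : I.vars c 0 ≠ I.vars c 1 := fun h => absurd (hI.2 c h) (by decide)
  have hJr' : (J₀.erase c).card ≤ r := (card_le_card (erase_subset c J₀)).trans hJr
  have hdisj' : Disjoint (J₀.erase c) G := (hdisj.mono_left (erase_subset c J₀)).mono_right hG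
  -- `a, b` are XOR-type: no monomial of `G` contains them
  have hGa : ∀ g ∈ G, I.vars g 2 ≠ I.vars c 0 ∧ I.vars g 3 ≠ I.vars c 0 :=
    fun g _ => ⟨fun e => hT c g 0 2 (by decide) (by decide) e.symm, fun e => hT c g 0 3 (by decide) (by decide) e.symm⟩
  have hGb : ∀ g ∈ G, I.vars g 2 ≠ I.vars c 1 ∧ I.vars g 3 ≠ I.vars c 1 :=
    fun g _ => ⟨fun e => hT c g 1 2 (by decide) (by decide) e.symm, fun e => hT c g 1 3 (by decide) (by decide) e.symm⟩
  -- the slice is non-empty: a solution of `J₀ ∖ c` with the pair read prescribed (`gSat`)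
  obtain ⟨x₁, hx₁, hx₁s⟩ : ∃ x : Fin n → Bool, (∀ j ∈ J₀.erase c, I.eval x j = y j) ∧ xor (x (I.vars c 0)) (x (I.vars c 1)) = t := by
    have hnc : ∃ u u' : Fin n → Bool, gval I {I.vars c 0, I.vars c 1} ∅ u ≠ gval I {I.vars c 0, I.vars c 1} ∅ u' := by
      refine ⟨fun v => decide (v = I.vars c 0), fun _ => false, ?_⟩
      rw [gval_pair I h01, gval_pair I h01]
      simp [h01.symm]
    obtain ⟨x, hx, hxab⟩ := gSat n m r I hI hT hB hS y (J₀.erase c) ∅ {I.vars c 0, I.vars c 1} t hJr' (disjoint_empty_right _) hnc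
    rw [gval_pair I h01] at hxab
    exact ⟨x, hx, hxab⟩
  -- if `R` alone misses `b` on `Sol(J₀ ∖ c)`, it is constant (`gSat`)
  by_cases hR : ∃ x : Fin n → Bool, (∀ j ∈ J₀.erase c, I.eval x j = y j) ∧ gval I C G x = b
  swap
  · push Not at hR
    have hconst : ∀ u u' : Fin n → Bool, gval I C G u = gval I C G u' := by
      by_contra hnc
      push Not at hnc
      obtain ⟨u, u', huu⟩ := hnc
      obtain ⟨x, hx, hxb⟩ := gSat n m r I hI hT hB hS y (J₀.erase c) G C b hJr' hdisj' ⟨u, u', huu⟩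
      exact hR x hx hxb
    exact ⟨fun _ => gval I C G x₁, fun x => hconst x x₁⟩
  obtain ⟨x₀, hx₀, hx₀b⟩ := hR
  -- a cardinality-minimal infeasible sub-family
  set P : Finset (Finset (Fin m)) := (J₀.erase c).powerset.filter fun K =>
    ¬ ∃ x : Fin n → Bool, (∀ j ∈ K, I.eval x j = y j) ∧ xor (x (I.vars c 0)) (x (I.vars c 1)) = t ∧ gval I C G x = b with hP
  have hPne : P.Nonempty := ⟨J₀.erase c, mem_filter.2 ⟨mem_powerset.2 (Subset.refl _), fun ⟨x, hx, hxs, hxb⟩ => hfail x hx hxs hxb⟩⟩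
  obtain ⟨K, hKP, hKmin⟩ := exists_min_image P Finset.card hPne
  rw [mem_filter, mem_powerset] at hKP
  obtain ⟨hKsub, hKT3⟩ := hKP
  by_cases hKne : K.Nonempty
  · -- `K` is a pair-core: contradiction
    refine absurd ⟨hKne, hKT3, fun f hf => ?_, ⟨x₀, fun j hj => hx₀ j (hKsub hj), hx₀b⟩, ⟨x₁, fun j hj => hx₁ j (hKsub hj), hx₁s⟩⟩
      (hno K hKsub C G t b hG)
    by_contra hnw
    have hmem : K.erase f ∈ P := mem_filter.2 ⟨mem_powerset.2 ((erase_subset f K).trans hKsub), hnw⟩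
    have := hKmin _ hmem
    rw [card_erase_of_mem hf] at this
    have hpos := card_pos.2 hKne
    omega
  · -- `K = ∅`: the two constraints alone are infeasible
    rw [not_nonempty_iff_eq_empty] at hKne
    subst hKne
    exact phi_of_forall_ne hI hS h01 hGa hGb fun x hxs hxb => hKT3 ⟨x, fun j hj => absurd hj (notMem_empty j), hxs, hxb⟩

end Reduction

end Summit.PneNP.PneNP.Theorems.PstarChordReadPairCore
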